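import Summits.QuantumFields.YangMills.Theorems.UnitScaleTiltProp8LinAvgFluxExact
import HarnessLib

/-!
# Route `UnitScaleTilt`, crux K1 «MinimiserStabilityRegPr» (stmt-QuantumFields-19200) — route-R E′ (A′)-comb, COMB-FLAT-COERCIVITY sub-lemma (I3′) «δQ-SLICE», FILE F-c-2 (iii-a):
# **RIBBONS AND SWEPT SURFACES AS PLAQUETTE CHAINS** — the signed sums of unit plaquette circulations produced by WALK STOKES (`…Prop7WalkStokes`) rewritten in the
# format of FILE B's filling certificate, `Σ_p S(p) • curl 1 Y p` with an EXPLICIT real weight `S`, plus the two size facts the certificate's `A` is made of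

Cell `ym3-torus`, width seat `ym-ust-19200-w4` (gen 8; (I3′) LOCATE-first taker, RULING №18 (2)).  THEOREMS ONLY (0 `def`, 0 `sorry`); `--supports stmt-QuantumFields-19200`,
count-neutral.  YM₃ on T³ is a ladder rung (R3), not the Clay problem; nothing here claims (I3′), COMB-FLAT-COERCIVITY, `norm_G₀ᶜ`, hcoS, E′, EX, the crux, d = 4 or the mass gap.

WHY.  FILE B (✓p699033 `Prop7SliceRowOfFilling`) wants, per coarse bond, a real 2-chain `S_c : Plaq → ℝ` with `defect = Σ_p S_c(p) • curl 1 X p`, `Σ_p S_c(p)² ≤ A`, overlap `≤ M`.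
WALK STOKES (`Prop7WalkStokes.walkSum_shift_sub` ∕ `walkSum_walkEnd_sub`) and F-c-1 produce the fillings as `walkSum`s of the PLAQUETTE FIELD `b ↦ Y⟨b₋, dir b⟩ + Y⟨b₋+e_{dir b}, κ⟩ −
Y⟨b₋+e_κ, dir b⟩ − Y⟨b₋, κ⟩` along walks (ribbons) and `walkSum`s of ribbons along connector words (swept surfaces).  This file converts between the two formats once and for all:
(§1) `walkSum` is linear in a bond function of the shape `b ↦ Σ_p f b p • Z p`: `walkSum (b ↦ Σ_p f b p • Z p) γ = Σ_p (Σ_{s∈γ} ±f (bond s) p) • Z p`; (§2) the plaquette field of ONE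
bond is `Σ_p inc_κ(b, p) • curl 1 Y p` with the oriented incidence weight `inc_κ(b,p) ∈ {0, ±1}` (`+1` at `⟨b₋, dir b, κ⟩` if `dir b < κ`, `−1` at `⟨b₋, κ, dir b⟩` if `κ < dir b`, `0` if
`κ = dir b`), hence (§2) a RIBBON is `Σ_p S_γ(p) • curl 1 Y p`, `S_γ(p) = Σ_{s∈γ} ±inc_κ(bond s, p)`, and (§3) a SWEPT SURFACE is `Σ_p (Σ_{t ∈ walk x u} ±S_{walk t₋ w, dir t}(p)) • curl 1 Y p`;
(§4) sizes: `Σ_p |inc_κ(b,p)| ≤ 1`, so `Σ_p |S_γ(p)| ≤ |γ|`, and the abstract step `(∀ p, |a p| ≤ m) → Σ_p |a p| ≤ T → Σ_p (a p)² ≤ m·T` — for a THIN ribbon (multiplicity `m`) the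
certificate's share is `≤ m·|γ|` (NOT `|γ|²`: LOCATE v2 d592d91c §4 needs the thin form — trap (T-b)).

WHAT IS PROVED (ns `…Theorems.Prop7RibbonPlaquetteChains`; `[AddCommGroup V] [Module ℝ V]`, any torus; classical decidability of plaquette equality):
`walkSum_sum_smul` (§1) · `plaqField_eq_sum_inc_smul_curl`, ★★`walkSum_plaqField_eq_sum_smul_curl` (§2, ribbon as a chain) · ★★`walkSum_ribbon_eq_sum_smul_curl` (§3, surface as a
chain) · `sum_abs_inc_le_one`, ★`sum_abs_ribbonWeight_le_length`, `sum_sq_le_mul_of_abs_le` (§4).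
HONEST SCOPE: format conversions and two counting facts; no estimate on any actual `δQ` piece; (I3′)∕COMB-FLAT-COERCIVITY∕A6ᶜ OPEN.  Rung R3, not Clay; YM gap NOT proved.

References: T. Bałaban, CMP 95 (1984) 17–40 [Balaban1984PropagatorsI] ((1.2) p.18, (1.9) p.19); CMP 99 (1985) 389–434 [Balaban1985BackgroundPropagators] ((3.16) p.393, Thm 3.11 p.416).
-/

noncomputable section

open scoped BigOperators

namespace Summit.QuantumFields.YangMills.Theorems.Prop7RibbonPlaquetteChains

open Literature.MathematicalPhysics.QuantumFieldTheory.Balaban1983to89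
open T4Continuum BlockAveraging BlockAveragingEMLLinearised LatticeFieldCalculus

variable {P : Params} {j : ℕ} {V : Type*} [AddCommGroup V] [Module ℝ V]

/-! ## §1 `walkSum` of a bond function that is a plaquette chain -/

/-- **LINEARITY OF `walkSum` IN A CHAIN-VALUED BOND FUNCTION**: `walkSum (b ↦ Σ_p f b p • Z p) γ = Σ_p (Σ_{s ∈ γ} ±f (bond s) p) • Z p` (signs as in `walkSum`: `+` forward, `−`
backward). [cite: Balaban1984PropagatorsI, (1.8) p.19] -/
theorem walkSum_sum_smul {π : Type*} [Fintype π] (f : PBond P j → π → ℝ) (Z : π → V) : ∀ γ : List (LStep P j),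
    walkSum (fun b : PBond P j => ∑ p, f b p • Z p) γ = ∑ p, ((γ.map fun s => (if s.fwd then (1 : ℝ) else -1) * f s.bond p).sum) • Z p
  | [] => by simp
  | s :: γ => by
    rw [walkSum_cons, walkSum_sum_smul f Z γ]
    simp only [List.map_cons, List.sum_cons, add_smul, Finset.sum_add_distrib]
    congr 1
    cases hs : s.fwd
    · simp only [Bool.false_eq_true, if_false, neg_mul, one_mul, neg_smul, Finset.sum_neg_distrib]
    · simp only [if_true, one_mul]

/-! ## §2 The plaquette field of a bond, and ribbons, as plaquette chains -/

section Chains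

open Classical in
/-- The plaquette field of ONE bond is the chain of its oriented incidence weight: `Y⟨b₋,dir b⟩ + Y⟨b₋+e_{dir b},κ⟩ − Y⟨b₋+e_κ,dir b⟩ − Y⟨b₋,κ⟩ = Σ_p inc_κ(b,p) • curl 1 Y p`
(`inc = +1` at `⟨b₋, dir b, κ⟩` when `dir b < κ`, `−1` at `⟨b₋, κ, dir b⟩` when `κ < dir b`, nothing when `κ = dir b`). [cite: Balaban1984PropagatorsI, (1.2) p.18] -/
theorem plaqField_eq_sum_inc_smul_curl (Y : PBond P j → V) (κ : Fin P.d) (b : PBond P j) :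
    Y ⟨b.src, b.dir⟩ + Y ⟨b.src.shift b.dir, κ⟩ - Y ⟨b.src.shift κ, b.dir⟩ - Y ⟨b.src, κ⟩
      = ∑ p : Plaq P j,
          ((if h : b.dir < κ then (if p = ⟨b.src, b.dir, κ, h⟩ then (1 : ℝ) else 0) else 0)
            - (if h : κ < b.dir then (if p = ⟨b.src, κ, b.dir, h⟩ then (1 : ℝ) else 0) else 0)) • curl 1 Y p := by
  rcases lt_trichotomy b.dir κ with h | h | h
  · have hn : ¬ κ < b.dir := not_lt.2 h.le
    simp only [h, hn, dif_pos, dif_neg, not_false_eq_true, sub_zero, ite_smul, one_smul, zero_smul, Finset.sum_ite_eq', Finset.mem_univ,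
      if_true]
    rw [curl, one_smul]
  · have hn : ¬ κ < b.dir := by rw [h]; exact lt_irrefl _
    have hn' : ¬ b.dir < κ := by rw [h]; exact lt_irrefl _
    simp only [hn, hn', dif_neg, not_false_eq_true, sub_zero, zero_smul, Finset.sum_const_zero]
    rw [h]; abel
  · have hn : ¬ b.dir < κ := not_lt.2 h.le
    simp only [h, hn, dif_pos, dif_neg, not_false_eq_true, zero_sub, neg_smul, ite_smul, one_smul, zero_smul, Finset.sum_neg_distrib,
      Finset.sum_ite_eq', Finset.mem_univ, if_true]
    rw [curl, one_smul]
    abel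

open Classical in
/-- ★★ **A RIBBON IS A PLAQUETTE CHAIN**: the signed sum along `γ` of the plaquette fields (the ribbon of WALK STOKES) is `Σ_p S_γ(p) • curl 1 Y p` with the explicit weight
`S_γ(p) = Σ_{s ∈ γ} ±inc_κ(bond s, p)`. [cite: Balaban1984PropagatorsI, (1.9) p.19] -/
theorem walkSum_plaqField_eq_sum_smul_curl (Y : PBond P j → V) (κ : Fin P.d) (γ : List (LStep P j)) :
    walkSum (fun b : PBond P j => Y ⟨b.src, b.dir⟩ + Y ⟨b.src.shift b.dir, κ⟩ - Y ⟨b.src.shift κ, b.dir⟩ - Y ⟨b.src, κ⟩) γ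
      = ∑ p : Plaq P j,
          ((γ.map fun s => (if s.fwd then (1 : ℝ) else -1) *
              ((if h : s.bond.dir < κ then (if p = ⟨s.bond.src, s.bond.dir, κ, h⟩ then (1 : ℝ) else 0) else 0)
                - (if h : κ < s.bond.dir then (if p = ⟨s.bond.src, κ, s.bond.dir, h⟩ then (1 : ℝ) else 0) else 0))).sum) • curl 1 Y p := by
  have hf : (fun b : PBond P j => Y ⟨b.src, b.dir⟩ + Y ⟨b.src.shift b.dir, κ⟩ - Y ⟨b.src.shift κ, b.dir⟩ - Y ⟨b.src, κ⟩)
      = fun b : PBond P j => ∑ p : Plaq P j,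
          ((if h : b.dir < κ then (if p = ⟨b.src, b.dir, κ, h⟩ then (1 : ℝ) else 0) else 0)
            - (if h : κ < b.dir then (if p = ⟨b.src, κ, b.dir, h⟩ then (1 : ℝ) else 0) else 0)) • curl 1 Y p :=
    funext fun b => plaqField_eq_sum_inc_smul_curl Y κ b
  rw [hf]
  exact walkSum_sum_smul _ _ γ

/-! ## §3 Swept surfaces as plaquette chains -/

open Classical in
/-- ★★ **A SWEPT SURFACE IS A PLAQUETTE CHAIN**: the signed sum over the steps `t` of a connector walk `δ` of the ribbons of `w` based at `t₋` in direction `dir t` (the surface of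
`Prop7WalkStokes.walkSum_walkEnd_sub`) is `Σ_p (Σ_{t ∈ δ} ± S_{walk t₋ w, dir t}(p)) • curl 1 Y p`. [cite: Balaban1984PropagatorsI, (1.9) p.19] -/
theorem walkSum_ribbon_eq_sum_smul_curl (Y : PBond P j → V) (w : List (Letter P.d)) (δ : List (LStep P j)) :
    walkSum (fun t : PBond P j =>
        walkSum (fun b : PBond P j => Y ⟨b.src, b.dir⟩ + Y ⟨b.src.shift b.dir, t.dir⟩ - Y ⟨b.src.shift t.dir, b.dir⟩ - Y ⟨b.src, t.dir⟩) (walk t.src w)) δ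
      = ∑ p : Plaq P j,
          ((δ.map fun t => (if t.fwd then (1 : ℝ) else -1) *
              (((walk t.bond.src w).map fun s => (if s.fwd then (1 : ℝ) else -1) *
                  ((if h : s.bond.dir < t.bond.dir then (if p = ⟨s.bond.src, s.bond.dir, t.bond.dir, h⟩ then (1 : ℝ) else 0) else 0)
                    - (if h : t.bond.dir < s.bond.dir then (if p = ⟨s.bond.src, t.bond.dir, s.bond.dir, h⟩ then (1 : ℝ) else 0) else 0))).sum)).sum)
            • curl 1 Y p := by
  have hf : (fun t : PBond P j =>
        walkSum (fun b : PBond P j => Y ⟨b.src, b.dir⟩ + Y ⟨b.src.shift b.dir, t.dir⟩ - Y ⟨b.src.shift t.dir, b.dir⟩ - Y ⟨b.src, t.dir⟩) (walk t.src w))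
      = fun t : PBond P j => ∑ p : Plaq P j,
          (((walk t.src w).map fun s => (if s.fwd then (1 : ℝ) else -1) *
              ((if h : s.bond.dir < t.dir then (if p = ⟨s.bond.src, s.bond.dir, t.dir, h⟩ then (1 : ℝ) else 0) else 0)
                - (if h : t.dir < s.bond.dir then (if p = ⟨s.bond.src, t.dir, s.bond.dir, h⟩ then (1 : ℝ) else 0) else 0))).sum) • curl 1 Y p :=
    funext fun t => walkSum_plaqField_eq_sum_smul_curl Y t.dir (walk t.src w)
  rw [hf]
  exact walkSum_sum_smul _ _ δ

/-! ## §4 Sizes: one plaquette per step, so `Σ_p |S_γ(p)| ≤ |γ|`, and the thin-ribbon square bound -/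

open Classical in
/-- One bond touches at most one plaquette of the ribbon: `Σ_p |inc_κ(b, p)| ≤ 1`. [folklore] -/
theorem sum_abs_inc_le_one (κ : Fin P.d) (b : PBond P j) :
    ∑ p : Plaq P j, |(if h : b.dir < κ then (if p = ⟨b.src, b.dir, κ, h⟩ then (1 : ℝ) else 0) else 0)
        - (if h : κ < b.dir then (if p = ⟨b.src, κ, b.dir, h⟩ then (1 : ℝ) else 0) else 0)| ≤ 1 := by
  rcases lt_trichotomy b.dir κ with h | h | h
  · have hn : ¬ κ < b.dir := not_lt.2 h.le
    simp only [h, hn, dif_pos, dif_neg, not_false_eq_true, sub_zero]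
    rw [Finset.sum_eq_single_of_mem (⟨b.src, b.dir, κ, h⟩ : Plaq P j) (Finset.mem_univ _) (fun p _ hp => by rw [if_neg hp, abs_zero])]
    simp
  · have hn : ¬ κ < b.dir := by rw [h]; exact lt_irrefl _
    have hn' : ¬ b.dir < κ := by rw [h]; exact lt_irrefl _
    simp [hn, hn']
  · have hn : ¬ b.dir < κ := not_lt.2 h.le
    simp only [h, hn, dif_pos, dif_neg, not_false_eq_true, zero_sub, abs_neg]
    rw [Finset.sum_eq_single_of_mem (⟨b.src, κ, b.dir, h⟩ : Plaq P j) (Finset.mem_univ _) (fun p _ hp => by rw [if_neg hp, abs_zero])]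
    simp

open Classical in
/-- ★ **A RIBBON HAS AT MOST ONE PLAQUETTE PER STEP**: `Σ_p |S_γ(p)| ≤ |γ|`. [cite: Balaban1984PropagatorsI, (1.9) p.19] -/
theorem sum_abs_ribbonWeight_le_length (κ : Fin P.d) : ∀ γ : List (LStep P j),
    ∑ p : Plaq P j, |(γ.map fun s => (if s.fwd then (1 : ℝ) else -1) *
        ((if h : s.bond.dir < κ then (if p = ⟨s.bond.src, s.bond.dir, κ, h⟩ then (1 : ℝ) else 0) else 0)
          - (if h : κ < s.bond.dir then (if p = ⟨s.bond.src, κ, s.bond.dir, h⟩ then (1 : ℝ) else 0) else 0))).sum| ≤ γ.length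
  | [] => by simp
  | s :: γ => by
    have ih := sum_abs_ribbonWeight_le_length κ γ
    have h1 := sum_abs_inc_le_one κ s.bond
    simp only [List.map_cons, List.sum_cons, List.length_cons, Nat.cast_add, Nat.cast_one]
    -- triangle inequality termwise, then the two bounds
    have hsign : |(if s.fwd then (1 : ℝ) else -1)| = 1 := by cases s.fwd <;> simp
    calc ∑ p : Plaq P j, |(if s.fwd then (1 : ℝ) else -1) *
              ((if h : s.bond.dir < κ then (if p = ⟨s.bond.src, s.bond.dir, κ, h⟩ then (1 : ℝ) else 0) else 0)
                - (if h : κ < s.bond.dir then (if p = ⟨s.bond.src, κ, s.bond.dir, h⟩ then (1 : ℝ) else 0) else 0))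
            + (γ.map fun s => (if s.fwd then (1 : ℝ) else -1) *
              ((if h : s.bond.dir < κ then (if p = ⟨s.bond.src, s.bond.dir, κ, h⟩ then (1 : ℝ) else 0) else 0)
                - (if h : κ < s.bond.dir then (if p = ⟨s.bond.src, κ, s.bond.dir, h⟩ then (1 : ℝ) else 0) else 0))).sum|
        ≤ ∑ p : Plaq P j, (|(if h : s.bond.dir < κ then (if p = ⟨s.bond.src, s.bond.dir, κ, h⟩ then (1 : ℝ) else 0) else 0)
                - (if h : κ < s.bond.dir then (if p = ⟨s.bond.src, κ, s.bond.dir, h⟩ then (1 : ℝ) else 0) else 0)|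
            + |(γ.map fun s => (if s.fwd then (1 : ℝ) else -1) *
              ((if h : s.bond.dir < κ then (if p = ⟨s.bond.src, s.bond.dir, κ, h⟩ then (1 : ℝ) else 0) else 0)
                - (if h : κ < s.bond.dir then (if p = ⟨s.bond.src, κ, s.bond.dir, h⟩ then (1 : ℝ) else 0) else 0))).sum|) := by
          refine Finset.sum_le_sum fun p _ => (abs_add_le _ _).trans ?_
          rw [abs_mul, hsign, one_mul]
      _ ≤ 1 + γ.length := by
          rw [Finset.sum_add_distrib]
          exact add_le_add h1 ih
      _ = γ.length + 1 := add_comm _ _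

end Chains

/-- **THE THIN-RIBBON SQUARE BOUND** (abstract): if `|a p| ≤ m` for all `p` and `Σ_p |a p| ≤ T`, then `Σ_p (a p)² ≤ m·T` — with §4's `T = |γ|` and the word's multiplicity `m`
this is the ribbon's share `A_γ ≤ m·|γ|` of FILE B's certificate (the thin form LOCATE v2 §4 uses; the crude `T²` would lose a factor `|γ|∕m`). [folklore] -/
theorem sum_sq_le_mul_of_abs_le {π : Type*} (s : Finset π) (a : π → ℝ) {m T : ℝ} (hm : ∀ p ∈ s, |a p| ≤ m) (hT : ∑ p ∈ s, |a p| ≤ T)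
    (hm0 : 0 ≤ m) : ∑ p ∈ s, a p ^ 2 ≤ m * T := by
  calc ∑ p ∈ s, a p ^ 2 = ∑ p ∈ s, |a p| * |a p| := Finset.sum_congr rfl fun p _ => by rw [sq, ← abs_mul_abs_self]
    _ ≤ ∑ p ∈ s, m * |a p| := Finset.sum_le_sum fun p hp => mul_le_mul_of_nonneg_right (hm p hp) (abs_nonneg _)
    _ = m * ∑ p ∈ s, |a p| := (Finset.mul_sum _ _ _).symm
    _ ≤ m * T := mul_le_mul_of_nonneg_left hT hm0

end Summit.QuantumFields.YangMills.Theorems.Prop7RibbonPlaquetteChains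

end
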